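import Literature.MathematicalPhysics.QuantumFieldTheory.Balaban1983to89.HaarExpChartChangeOfVariablesPiMeasure
import Literature.MeasureTheory.Integral.PushforwardDensityChartTransport

/-!
# `Balaban1983to89.HaarExpChartLocalFaceTransport` — THE LOCAL JACOBIAN FACE ON `G^B` FROM ITS FLAT READING: for a measurable
# map `M : G^B → G^{B'}` between products of a compact linear group, the push-forward-density statement for the chart-read map
# `A ↦ Λ^{B'}(M(Θ^B(A)·U₀)·(M U₀)⁻¹)` at `0` (w.r.t. `⊗η`) becomes the same statement for `M` at `U₀` (w.r.t. product Haar `⊗μ`)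
# — [Helgason2000] Ch. I Thm. 1.14 (13) ∕ [Balaban1985UV3] (18) as the chart data of `PushforwardDensityChartTransport`

statement-level skeleton of published theorems with citation tags; proofs where landed; nothing here is a claim
about the Yang–Mills mass gap

Cell `pub-ymgap` (YM-PLAN Track A), node N09 [B12] width seat `pub-ymgap-dag-n09-w2` (gen 4; helper lane of the K1⁷ item
stmt-QuantumFields-20542, count-neutral).  The LOCAL ROUTE to node00-def-K0e's (F1) «Jacobian face of [Balaban1987RG1] (0.4)»:
flat local engines (`Literature/MeasureTheory/Integral/SubmersionPushforwardDensity`, `…AnalyticSubmersionSharpDensity`) →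
chart transport (`…PushforwardDensityChartTransport.localFace_of_chartRead`, abstract) → gluing on the compact source
(`…PushforwardDensityGluing.exists_continuous_density_of_locally'`) → the (0.13) test identity → the record's door
`Node00.RegSetOfFibredChart.subset_regSetOfRecord_of_forall_integral_eq`.  THIS FILE supplies the chart-transport step AT THE
GROUP: the DISPLAYED chart data of the abstract lemma are DISCHARGED for the bond-wise exponential windows `Θ^B(B(0,s))·U₀` of
lit-balaban p28 (`HaarExponentialChart*`: `Θ = expChart`, `Λ = logChart`, `|det jac|`, `σ₀ = μ(V_s)∕ν_s(V_s)`) using dag-n09-w4 g4's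
translated-window identity `IsChartRep.pi_haar_restrict_translate_image_eq_smul` (`HaarExpChartChangeOfVariablesPiMeasure` §4)
on BOTH sides, the radius `s = min(s_C, s₀)` being chosen inside the proof (`s₀` from `exists_ball_det_jac_pos`: `det jac > 0`).

WHAT IS PROVED (namespace `…HaarExponentialChart.IsChartRep`, dot-notation on `h : IsChartRep C ρ`; `G` compact, `μ` a Haar
measure on `G` that is right invariant, `η` an additive Haar measure on `𝔤 = C.lie`).
* `continuousOn_logChart`, `measurable_logChart`, `logChart_one` — the log chart is continuous on `{‖ρ g − 1‖ < r_C}`, Borel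
  measurable, and `Λ 1 = 0`.
* `isOpen_image_piExpChart_translate` — `A ↦ Θ^B(A)·U₀` maps open subsets of `B(0,s)` (`s ≤ s_C`) to open subsets of `G^B`.
* ★★★ **`localFace_pi_haar_of_chartRead`** — for finite bond types `B`, `B'`, a measurable `M : (B → G) → (B' → G)` continuous
  at `U₀`, an exemption predicate `Q`: IF the chart-read map `A ↦ (b' ↦ Λ(M(b ↦ Θ(A b)·U₀ b) b' · (M U₀ b')⁻¹))` carries at `0` the
  FLAT local face w.r.t. `⊗_B η`, `⊗_{B'} η` (engine form — the conclusion shape of the two flat engines), THEN `M` carries at `U₀`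
  the local face w.r.t. `⊗_B μ`, `⊗_{B'} μ` in the SHARP form = VERBATIM the per-point clause `hloc` of
  `PushforwardDensityGluing.exists_continuous_density_of_locally'` on the compact source `B → G`.
* ★★★ **`exists_continuous_density_pi_haar_of_flatLocalFaces`** — THE LOCAL ROUTE ASSEMBLED AT THE GROUP: flat local faces of the
  chart-read `M` at every point of a CLOSED set `K` of configurations ⇒ every measurable bounded `r ≥ 0` vanishing off `K` and
  continuous at the non-exempt points of `K` has under `M` a push-forward density `g ≥ 0` CONTINUOUS ON ALL OF `G^{B'}` w.r.t. the
  product Haar measures, with the (0.13)-shaped test identity `∫ r·(f∘M) d(⊗μ) = ∫ g·f d(⊗μ)` — the hypothesis `h` of the record's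
  continuous-candidate door `Node00.RegSetOfFibredChart.subset_regSetOfRecord_of_forall_integral_eq` for EVERY open `U`.
* `flatFace_chartRead_of_engineFace`, `piLogChart_translate_self` — BRIDGE: a producer's flat face in the ENGINE's own output shape
  (`SubmersionPushforward.exists_continuousOn_density_map_of_submersion` applied to the chart-read map at `a = 0`) is the `hflat` of
  §4–§5 with the idle exemption `Q ≡ True`.
* (v1.1) §8 THE CHAIN WITH SHARP-FORM FLAT FACES: `localFace_pi_haar_of_chartRead'`, `exists_continuous_density_pi_haar_of_flatLocalFaces'`
  (flat faces asked only of densities continuous at every point off `O ∩ {¬Q}` — weaker input, monotone under cutting), and the two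
  bookkeeping moves `sharpFlatFace_of_flatFace` (engine-form ⇒ sharp-form) and `sharpFlatFace_cut` (window cut + exemption change —
  the move needed where only some sharp thresholds are active).
* (v1.1) `flatFace_chartRead_of_sharpEngineFace` — the same for the SHARP engines (densities continuous only on a flat exemption
  set `Qflat` of the chart — `g ≠ 0` for `AnalyticSubmersion…_sharp`, `∀ i, g i ≠ 0` for a finite threshold family — and any
  configuration-space exemption `Q` with `Qflat → Q ∘ (Θ^B(·)·U₀)`).

HONEST SCOPE.  Instantiation ∕ bookkeeping only: no chart of Bałaban's constructed, no estimate; the flat face of the chart-read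
block averaging of record (an analytic-submersion property on the guard, (M3r)), the thresholds' transversality and N07's
continuity input stay located-open; `hreg`∕`contTOn`∕`regSet`∕`TcanOfRecord` untouched; nothing of p28 ∕ dag-n09-w4's files ∕
Mathlib re-proved.
-/

noncomputable section

open NormedSpace Set Function Filter Topology MeasureTheory
open scoped ENNReal NNReal

namespace Literature.MathematicalPhysics.QuantumFieldTheory.Balaban1983to89.HaarExponentialChart

namespace IsChartRep

open MatrixLog (mlog analyticAt_mlog)
open B13HaarSigmaJacobian (jac)

variable {𝔸 : Type*} [NormedRing 𝔸] [NormedAlgebra ℂ 𝔸] [CompleteSpace 𝔸]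
variable {G : Type*} [Group G] [TopologicalSpace G] [IsTopologicalGroup G] [CompactSpace G]
variable {C : LogChart 𝔸} {ρ : G →* 𝔸} (h : IsChartRep C ρ)

/-! ## §1 The log chart: continuity, measurability, value at `1` -/

omit [IsTopologicalGroup G] [CompactSpace G] in
/-- `Λ` is continuous on `{g : ‖ρ g − 1‖ < r_C}` (there `Λ g = log ρ(g)`, `log` analytic on `‖· − 1‖ < 1`).
[cite: Helgason2000, Ch. I §1 Thm. 1.14 (13) p. 96] -/
theorem continuousOn_logChart : ContinuousOn h.logChart {g : G | ‖ρ g - 1‖ < innerRadius C} := by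
  rw [Topology.IsInducing.subtypeVal.continuousOn_iff]
  have hcont : ContinuousOn (fun g : G => mlog (ρ g)) {g : G | ‖ρ g - 1‖ < innerRadius C} := by
    intro g hg
    have hg1 : ‖ρ g - 1‖ < 1 := lt_of_lt_of_le hg (innerRadius_le_half.trans (by norm_num))
    exact ((analyticAt_mlog hg1).continuousAt.comp h.continuous.continuousAt).continuousWithinAt
  exact hcont.congr fun g hg => by simp only [Function.comp_apply, h.coe_logChart hg]

omit [CompleteSpace 𝔸] [IsTopologicalGroup G] [CompactSpace G] in
/-- `Λ 1 = 0` (`Λ(Θ 0) = 0`, `Θ 0 = 1`). [cite: Helgason2000, Ch. I §1 Thm. 1.14 (13) p. 96] -/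
theorem logChart_one [CompleteSpace 𝔸] : h.logChart 1 = 0 := by
  have h1 := h.logChart_expChart (X := (0 : C.lie)) (by simpa using chartRadius_pos (C := C))
  rwa [h.expChart_zero] at h1

variable [MeasurableSpace C.lie] [BorelSpace C.lie] [MeasurableSpace G] [BorelSpace G]

omit [IsTopologicalGroup G] [CompactSpace G] in
/-- `Λ` is Borel measurable (continuous on the open set `{‖ρ g − 1‖ < r_C}`, constant `0` off it).
[cite: Helgason2000, Ch. I §1 Thm. 1.14 (13) p. 96] -/
theorem measurable_logChart : Measurable h.logChart := by
  have hU : IsOpen {g : G | ‖ρ g - 1‖ < innerRadius C} :=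
    isOpen_lt (continuous_norm.comp (h.continuous.sub continuous_const)) continuous_const
  refine measurable_of_restrict_of_restrict_compl hU.measurableSet ?_ ?_
  · exact (continuousOn_iff_continuous_restrict.1 h.continuousOn_logChart).measurable
  · have h2 : {g : G | ‖ρ g - 1‖ < innerRadius C}ᶜ.restrict h.logChart = fun _ => 0 := by
      funext g
      have hg : ¬ ‖ρ (g : G) - 1‖ < innerRadius C := g.2
      simp only [Set.restrict_apply, logChart, dif_neg hg]
    rw [h2]
    exact measurable_const

/-! ## §2 The translated product chart `A ↦ Θ^B(A)·U₀` is open on the ball `B(0,s)` -/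

variable {B : Type*} [Fintype B]

omit [IsTopologicalGroup G] [CompactSpace G] [MeasurableSpace C.lie] [BorelSpace C.lie] [MeasurableSpace G] [BorelSpace G] in
/-- `Λ^B` inverts the translated product chart on `B(0, s)`, `s ≤ s_C`. [cite: Helgason2000, Ch. I §1 Thm. 1.14 (13) p. 96] -/
theorem piLogChart_piExpChart_translate {s : ℝ} (hs : s ≤ chartRadius C) (U₀ : B → G) {A : B → C.lie}
    (hA : A ∈ Metric.ball (0 : B → C.lie) s) :
    (fun b => h.logChart ((fun b => h.expChart (A b) * U₀ b) b * (U₀ b)⁻¹)) = A := by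
  funext b
  rw [mem_ball_zero_iff] at hA
  have hb : ‖A b‖ < chartRadius C := (norm_le_pi_norm A b).trans_lt (hA.trans_le hs)
  simp only [mul_inv_cancel_right]
  exact h.logChart_expChart hb

omit [IsTopologicalGroup G] [CompactSpace G] [MeasurableSpace C.lie] [BorelSpace C.lie] [MeasurableSpace G] [BorelSpace G]
  [Fintype B] in
/-- `Θ^B(·)·U₀` inverts `Λ^B((·)·U₀⁻¹)` on the translated product window. [cite: Helgason2000, Ch. I §1 Thm. 1.14 (13) p. 96] -/
theorem piExpChart_translate_piLogChart {s : ℝ} (hs : s ≤ chartRadius C) (U₀ : B → G) {U : B → G}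
    (hU : ∀ b, U b * (U₀ b)⁻¹ ∈ h.window s) :
    (fun b => h.expChart ((fun b => h.logChart (U b * (U₀ b)⁻¹)) b) * U₀ b) = U := by
  funext b
  simp only
  rw [h.expChart_logChart_of_mem_window hs (hU b), inv_mul_cancel_right]

omit [IsTopologicalGroup G] [CompactSpace G] [MeasurableSpace C.lie] [BorelSpace C.lie] [MeasurableSpace G] [BorelSpace G] in
/-- The image of a subset `V ⊆ B(0,s)` under the translated product chart is the trace of `(Λ^B)⁻¹(V)` on the translated
product window. [cite: Helgason2000, Ch. I §1 Thm. 1.14 (13) p. 96] -/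
theorem image_piExpChart_translate_eq {s : ℝ} (hs : s ≤ chartRadius C) (U₀ : B → G) {V : Set (B → C.lie)}
    (hV : V ⊆ Metric.ball (0 : B → C.lie) s) :
    (fun (A : B → C.lie) (b : B) => h.expChart (A b) * U₀ b) '' V =
      {U : B → G | ∀ b, U b * (U₀ b)⁻¹ ∈ h.window s} ∩
        (fun (U : B → G) (b : B) => h.logChart (U b * (U₀ b)⁻¹)) ⁻¹' V := by
  ext U
  constructor
  · rintro ⟨A, hAV, rfl⟩
    have hA := hV hAV
    refine ⟨fun b => ?_, ?_⟩
    · simp only [mul_inv_cancel_right]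
      rw [mem_ball_zero_iff] at hA
      exact h.expChart_mem_window (mem_ball_zero_iff.2 ((norm_le_pi_norm A b).trans_lt hA))
    · show (fun b => h.logChart ((fun b => h.expChart (A b) * U₀ b) b * (U₀ b)⁻¹)) ∈ V
      rw [h.piLogChart_piExpChart_translate hs U₀ hA]
      exact hAV
  · rintro ⟨hUw, hUV⟩
    exact ⟨_, hUV, h.piExpChart_translate_piLogChart hs U₀ hUw⟩

omit [CompactSpace G] [MeasurableSpace C.lie] [BorelSpace C.lie] [MeasurableSpace G] [BorelSpace G] in
/-- The translated product window `{U : ∀ b, U b·U₀ b⁻¹ ∈ V_s}` is open. [cite: Helgason2000, Ch. I §1 Thm. 1.14 (13) p. 96] -/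
theorem isOpen_piWindow_translate {s : ℝ} (hs : s ≤ chartRadius C) (U₀ : B → G) :
    IsOpen {U : B → G | ∀ b, U b * (U₀ b)⁻¹ ∈ h.window s} := by
  have : {U : B → G | ∀ b, U b * (U₀ b)⁻¹ ∈ h.window s} = ⋂ b, (fun U : B → G => U b * (U₀ b)⁻¹) ⁻¹' h.window s := by
    ext U; simp
  rw [this]
  exact isOpen_iInter_of_finite fun b => (h.isOpen_window hs).preimage ((continuous_apply b).mul continuous_const)

omit [CompactSpace G] [MeasurableSpace C.lie] [BorelSpace C.lie] [MeasurableSpace G] [BorelSpace G] [Fintype B] in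
/-- `Λ^B((·)·U₀⁻¹)` is continuous on the translated product window. [cite: Helgason2000, Ch. I §1 Thm. 1.14 (13) p. 96] -/
theorem continuousOn_piLogChart_translate {s : ℝ} (hs : s ≤ chartRadius C) (U₀ : B → G) :
    ContinuousOn (fun (U : B → G) (b : B) => h.logChart (U b * (U₀ b)⁻¹))
      {U : B → G | ∀ b, U b * (U₀ b)⁻¹ ∈ h.window s} := by
  refine continuousOn_pi.2 fun b => h.continuousOn_logChart.comp
    (((continuous_apply b).mul continuous_const).continuousOn) fun U hU => ?_
  have hb := hU b
  rw [h.window_eq hs] at hb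
  exact hb.1

omit [CompactSpace G] [MeasurableSpace C.lie] [BorelSpace C.lie] [MeasurableSpace G] [BorelSpace G] in
/-- **The translated product chart is OPEN on `B(0,s)`**: images of open subsets of the ball are open in `G^B`.
[cite: Helgason2000, Ch. I §1 Thm. 1.14 (13) p. 96] -/
theorem isOpen_image_piExpChart_translate {s : ℝ} (hs : s ≤ chartRadius C) (U₀ : B → G) {V : Set (B → C.lie)}
    (hV : V ⊆ Metric.ball (0 : B → C.lie) s) (hVo : IsOpen V) :
    IsOpen ((fun (A : B → C.lie) (b : B) => h.expChart (A b) * U₀ b) '' V) := by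
  rw [h.image_piExpChart_translate_eq hs U₀ hV]
  exact (h.continuousOn_piLogChart_translate hs U₀).isOpen_inter_preimage (h.isOpen_piWindow_translate hs U₀) hVo

/-! ## §3 The translated product exponential window as chart data -/

variable [FiniteDimensional ℝ C.lie] (hlie : ∀ x ∈ C.lie, ∀ y ∈ C.lie, x * y - y * x ∈ C.lie)
variable (η : Measure C.lie) [η.IsAddHaarMeasure] (μ : Measure G) [μ.IsHaarMeasure]

include hlie in
/-- **THE TRANSLATED PRODUCT EXPONENTIAL WINDOW `Θ^B(B(0,s))·W₀` AS CHART DATA** (the hypotheses of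
`PushforwardDensityChartTransport.localFace_of_chartRead`, source or target side): for `0 < s ≤ s_C` with `det jac > 0` on
`B(0,s)`, the chart `Θ(A) = (Θ(A b)·W₀ b)_b` is measurable, continuous, injective and OPEN on `B(0,s)`, the real Jacobian
`J(A) = σ₀^{|B|}·Π_b |det jac(A b)|` is measurable, continuous, non-negative, bounded and POSITIVE on `B(0,s)`, the Haar identity
reads `(⊗μ)⌊Θ(B(0,s)) = Θ_*((J)·(⊗η)⌊B(0,s))` (dag-n09-w4's `pi_haar_restrict_translate_image_eq_smul`, scalar folded into `J`),
and the inverse chart `Λ(U) = (Λ(U b·W₀ b⁻¹))_b` is measurable, continuous on the window and inverts `Θ` on `B(0,s)`; `Θ 0 = W₀`.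
[cite: Helgason2000, Ch. I §1 Thm. 1.14 (13) p. 96] [cite: Balaban1985UV3, (18) p. 260] -/
theorem chartData_piExpChart_translate [μ.IsMulRightInvariant] {s : ℝ} (hs0 : 0 < s) (hs : s ≤ chartRadius C)
    (hjpos : ∀ x : C.lie, ‖x‖ < s → 0 < LinearMap.det (jac hlie x : C.lie →ₗ[ℝ] C.lie)) (W₀ : B → G) :
    Measurable (fun (A : B → C.lie) (b : B) => h.expChart (A b) * W₀ b) ∧
    ContinuousOn (fun (A : B → C.lie) (b : B) => h.expChart (A b) * W₀ b) (Metric.ball 0 s) ∧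
    InjOn (fun (A : B → C.lie) (b : B) => h.expChart (A b) * W₀ b) (Metric.ball 0 s) ∧
    (∀ V : Set (B → C.lie), V ⊆ Metric.ball 0 s → IsOpen V →
      IsOpen ((fun (A : B → C.lie) (b : B) => h.expChart (A b) * W₀ b) '' V)) ∧
    Measurable (fun A : B → C.lie => ((μ (h.window s) / h.chartMeasure hlie η s (h.window s)) ^ Fintype.card B).toReal *
      ∏ b, |LinearMap.det (jac hlie (A b) : C.lie →ₗ[ℝ] C.lie)|) ∧
    ContinuousOn (fun A : B → C.lie => ((μ (h.window s) / h.chartMeasure hlie η s (h.window s)) ^ Fintype.card B).toReal *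
      ∏ b, |LinearMap.det (jac hlie (A b) : C.lie →ₗ[ℝ] C.lie)|) (Metric.ball 0 s) ∧
    (∀ A : B → C.lie, 0 ≤ ((μ (h.window s) / h.chartMeasure hlie η s (h.window s)) ^ Fintype.card B).toReal *
      ∏ b, |LinearMap.det (jac hlie (A b) : C.lie →ₗ[ℝ] C.lie)|) ∧
    (∃ C₀ : ℝ, ∀ A ∈ Metric.ball (0 : B → C.lie) s,
      ((μ (h.window s) / h.chartMeasure hlie η s (h.window s)) ^ Fintype.card B).toReal *
        ∏ b, |LinearMap.det (jac hlie (A b) : C.lie →ₗ[ℝ] C.lie)| ≤ C₀) ∧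
    (∀ A ∈ Metric.ball (0 : B → C.lie) s,
      0 < ((μ (h.window s) / h.chartMeasure hlie η s (h.window s)) ^ Fintype.card B).toReal *
        ∏ b, |LinearMap.det (jac hlie (A b) : C.lie →ₗ[ℝ] C.lie)|) ∧
    (Measure.pi fun _ : B => μ).restrict ((fun (A : B → C.lie) (b : B) => h.expChart (A b) * W₀ b) '' Metric.ball 0 s) =
      (((Measure.pi fun _ : B => η).restrict (Metric.ball 0 s)).withDensity fun A =>
          ENNReal.ofReal (((μ (h.window s) / h.chartMeasure hlie η s (h.window s)) ^ Fintype.card B).toReal *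
            ∏ b, |LinearMap.det (jac hlie (A b) : C.lie →ₗ[ℝ] C.lie)|)).map
        (fun (A : B → C.lie) (b : B) => h.expChart (A b) * W₀ b) ∧
    Measurable (fun (U : B → G) (b : B) => h.logChart (U b * (W₀ b)⁻¹)) ∧
    ContinuousOn (fun (U : B → G) (b : B) => h.logChart (U b * (W₀ b)⁻¹))
      ((fun (A : B → C.lie) (b : B) => h.expChart (A b) * W₀ b) '' Metric.ball 0 s) ∧
    (∀ A ∈ Metric.ball (0 : B → C.lie) s,
      (fun b => h.logChart ((fun b => h.expChart (A b) * W₀ b) b * (W₀ b)⁻¹)) = A) ∧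
    (fun b => h.expChart ((0 : B → C.lie) b) * W₀ b) = W₀ := by
  haveI : T2Space G := h.isClosedEmbedding.isEmbedding.t2Space
  haveI := h.secondCountableTopology
  have hσtop : μ (h.window s) / h.chartMeasure hlie η s (h.window s) ≠ ∞ :=
    (ENNReal.div_lt_top (measure_ne_top _ _) (h.chartMeasure_window_ne_zero hlie η hs0 hs)).ne
  have hσpos : 0 < μ (h.window s) / h.chartMeasure hlie η s (h.window s) :=
    ENNReal.div_pos ((h.isOpen_window hs).measure_pos μ ⟨1, h.one_mem_window hs0⟩).ne'
      (h.chartMeasure_window_lt_top hlie η hs).ne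
  have hΘm : Measurable (fun (A : B → C.lie) (b : B) => h.expChart (A b) * W₀ b) :=
    measurable_pi_lambda _ fun b => (h.measurable_expChart.comp (measurable_pi_apply b)).mul_const _
  have hΘc : Continuous (fun (A : B → C.lie) (b : B) => h.expChart (A b) * W₀ b) :=
    continuous_pi fun b => (h.continuous_expChart.comp (continuous_apply b)).mul continuous_const
  have hΛΘ : ∀ A ∈ Metric.ball (0 : B → C.lie) s,
      (fun b => h.logChart ((fun b => h.expChart (A b) * W₀ b) b * (W₀ b)⁻¹)) = A :=
    fun A hA => h.piLogChart_piExpChart_translate hs W₀ hA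
  have hinj : InjOn (fun (A : B → C.lie) (b : B) => h.expChart (A b) * W₀ b) (Metric.ball 0 s) := by
    intro A hA A' hA' hAA'
    calc A = (fun b => h.logChart ((fun b => h.expChart (A b) * W₀ b) b * (W₀ b)⁻¹)) := (hΛΘ A hA).symm
      _ = (fun b => h.logChart ((fun b => h.expChart (A' b) * W₀ b) b * (W₀ b)⁻¹)) := by
          funext b
          have := congrFun hAA' b
          simp only at this
          simp only [this]
      _ = A' := hΛΘ A' hA'
  have hopen : ∀ V : Set (B → C.lie), V ⊆ Metric.ball 0 s → IsOpen V →
      IsOpen ((fun (A : B → C.lie) (b : B) => h.expChart (A b) * W₀ b) '' V) :=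
    fun V hV hVo => h.isOpen_image_piExpChart_translate hs W₀ hV hVo
  -- the Jacobian
  have hdetc : Continuous fun A : B → C.lie => ∏ b, |LinearMap.det (jac hlie (A b) : C.lie →ₗ[ℝ] C.lie)| :=
    continuous_finsetProd _ fun b _ => continuous_abs.comp ((continuous_det_jac hlie).comp (continuous_apply b))
  have hJc : Continuous fun A : B → C.lie =>
      ((μ (h.window s) / h.chartMeasure hlie η s (h.window s)) ^ Fintype.card B).toReal *
        ∏ b, |LinearMap.det (jac hlie (A b) : C.lie →ₗ[ℝ] C.lie)| := continuous_const.mul hdetc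
  have hJ0 : ∀ A : B → C.lie, 0 ≤ ((μ (h.window s) / h.chartMeasure hlie η s (h.window s)) ^ Fintype.card B).toReal *
      ∏ b, |LinearMap.det (jac hlie (A b) : C.lie →ₗ[ℝ] C.lie)| :=
    fun A => mul_nonneg ENNReal.toReal_nonneg (Finset.prod_nonneg fun b _ => abs_nonneg _)
  have hJC : ∃ C₀ : ℝ, ∀ A ∈ Metric.ball (0 : B → C.lie) s,
      ((μ (h.window s) / h.chartMeasure hlie η s (h.window s)) ^ Fintype.card B).toReal *
        ∏ b, |LinearMap.det (jac hlie (A b) : C.lie →ₗ[ℝ] C.lie)| ≤ C₀ := by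
    obtain ⟨C₀, hC₀⟩ := (isCompact_closedBall (0 : B → C.lie) s).exists_bound_of_continuousOn hJc.continuousOn
    refine ⟨C₀, fun A hA => ?_⟩
    have h1 := hC₀ A (Metric.ball_subset_closedBall hA)
    rw [Real.norm_eq_abs] at h1
    exact (le_abs_self _).trans h1
  have hJpos : ∀ A ∈ Metric.ball (0 : B → C.lie) s,
      0 < ((μ (h.window s) / h.chartMeasure hlie η s (h.window s)) ^ Fintype.card B).toReal *
        ∏ b, |LinearMap.det (jac hlie (A b) : C.lie →ₗ[ℝ] C.lie)| := by
    intro A hA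
    rw [mem_ball_zero_iff] at hA
    refine mul_pos (ENNReal.toReal_pos (pow_ne_zero _ hσpos.ne') (ENNReal.pow_ne_top hσtop)) ?_
    exact Finset.prod_pos fun b _ => abs_pos.2 (hjpos (A b) ((norm_le_pi_norm A b).trans_lt hA)).ne'
  -- the Haar identity on the translated window, rewritten with the real Jacobian
  have hcov : (Measure.pi fun _ : B => μ).restrict
      ((fun (A : B → C.lie) (b : B) => h.expChart (A b) * W₀ b) '' Metric.ball 0 s) =
      (((Measure.pi fun _ : B => η).restrict (Metric.ball 0 s)).withDensity fun A =>
          ENNReal.ofReal (((μ (h.window s) / h.chartMeasure hlie η s (h.window s)) ^ Fintype.card B).toReal *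
            ∏ b, |LinearMap.det (jac hlie (A b) : C.lie →ₗ[ℝ] C.lie)|)).map
        (fun (A : B → C.lie) (b : B) => h.expChart (A b) * W₀ b) := by
    have hT : MeasurableSet (Metric.ball (0 : B → C.lie) s) := measurableSet_ball
    have hTΩ : Metric.ball (0 : B → C.lie) s ⊆ Set.pi Set.univ fun _ => Metric.ball (0 : C.lie) s := by
      intro A hA
      rw [ball_pi _ hs0] at hA
      exact fun b hb => by simpa using hA b hb
    have key := h.pi_haar_restrict_translate_image_eq_smul hlie η μ B hs0 hs measurableSet_ball (h.injOn_expChart hs)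
      hT hTΩ W₀
    rw [image_image] at key
    rw [key]
    have hFm : Measurable fun A : B → C.lie => ∏ b, jacDensity hlie (A b) :=
      Finset.measurable_prod _ fun b _ => (measurable_jacDensity hlie).comp (measurable_pi_apply b)
    rw [← Measure.map_smul, ← withDensity_smul _ hFm]
    congr 2
    funext A
    simp only [Pi.smul_apply, smul_eq_mul]
    rw [ENNReal.ofReal_mul ENNReal.toReal_nonneg, ENNReal.ofReal_toReal (ENNReal.pow_ne_top hσtop),
      ENNReal.ofReal_prod_of_nonneg fun b _ => abs_nonneg _]
    rfl
  -- the inverse chart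
  have hΛm : Measurable (fun (U : B → G) (b : B) => h.logChart (U b * (W₀ b)⁻¹)) :=
    measurable_pi_lambda _ fun b => h.measurable_logChart.comp ((measurable_pi_apply b).mul_const _)
  have hΛc : ContinuousOn (fun (U : B → G) (b : B) => h.logChart (U b * (W₀ b)⁻¹))
      ((fun (A : B → C.lie) (b : B) => h.expChart (A b) * W₀ b) '' Metric.ball 0 s) := by
    rw [h.image_piExpChart_translate_eq hs W₀ Subset.rfl]
    exact (h.continuousOn_piLogChart_translate hs W₀).mono inter_subset_left
  have hΘ0 : (fun b => h.expChart ((0 : B → C.lie) b) * W₀ b) = W₀ := by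
    funext b
    simp [h.expChart_zero]
  exact ⟨hΘm, hΘc.continuousOn, hinj, hopen, hJc.measurable, hJc.continuousOn, hJ0, hJC, hJpos, hcov, hΛm, hΛc, hΛΘ, hΘ0⟩

/-! ## §4 The local Jacobian face on `G^B` from its flat reading -/

include hlie in
/-- ★★★ **THE LOCAL JACOBIAN FACE ON `G^B` FROM ITS FLAT READING.**  `B`, `B'` finite bond types, `M : (B → G) → (B' → G)`
measurable and continuous at `U₀`, `Q` an exemption predicate on `B → G`.  IF the chart-read map
`A ↦ (b' ↦ Λ(M(b ↦ Θ(A b)·U₀ b) b' · (M U₀ b')⁻¹))` carries at `0` the FLAT local face w.r.t. `⊗_B η`, `⊗_{B'} η` (engine form: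
open windows `O ∋ 0`, `D ∋ 0`; every measurable bounded `r̃ ≥ 0` vanishing off `O` and continuous at each `A ∈ O` with
`Q(Θ^B(A)·U₀)` has above `D` a density of its push-forward continuous on `D` — the conclusion shape of
`SubmersionPushforward.exists_continuousOn_density_map_of_submersion` ∕ `AnalyticSubmersion.…_sharp`), THEN `M` carries at `U₀`
the local face w.r.t. the product Haar measures `⊗_B μ`, `⊗_{B'} μ` in the SHARP form — verbatim the per-point clause `hloc` of
`PushforwardDensityGluing.exists_continuous_density_of_locally'`.  (The abstract chart transport `localFace_of_chartRead` with
the chart data of §3 on both sides at the radius `s = min(s_C, s₀)`, `s₀` the non-degeneracy radius of `det jac`, and an inner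
source ball inside the chart-readability region given by the continuity of `M` at `U₀`.)
[cite: Helgason2000, Ch. I §1 Thm. 1.14 (13) p. 96] [cite: Balaban1985UV3, (18) p. 260] -/
theorem localFace_pi_haar_of_chartRead [μ.IsMulRightInvariant] {B' : Type*} [Fintype B']
    {M : (B → G) → (B' → G)} (hMm : Measurable M) (U₀ : B → G) (hMc : ContinuousAt M U₀) (Q : (B → G) → Prop)
    (hflat : ∃ O : Set (B → C.lie), ∃ D : Set (B' → C.lie), IsOpen O ∧ (0 : B → C.lie) ∈ O ∧ IsOpen D ∧
      (0 : B' → C.lie) ∈ D ∧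
      ∀ r : (B → C.lie) → ℝ, Measurable r → (∀ A, 0 ≤ r A) →
        (∀ A ∈ O, Q (fun b => h.expChart (A b) * U₀ b) → ContinuousAt r A) →
        (∃ C₀ : ℝ, ∀ A, r A ≤ C₀) → (∀ A, A ∉ O → r A = 0) →
        ∃ I : (B' → C.lie) → ℝ, ContinuousOn I D ∧ (∀ w, 0 ≤ I w) ∧ ∀ A' : Set (B' → C.lie), MeasurableSet A' → A' ⊆ D →
          ((Measure.pi fun _ : B => η).withDensity fun A => ENNReal.ofReal (r A))
              ((fun (A : B → C.lie) (b' : B') =>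
                  h.logChart (M (fun b => h.expChart (A b) * U₀ b) b' * (M U₀ b')⁻¹)) ⁻¹' A') =
            ∫⁻ w in A', ENNReal.ofReal (I w) ∂(Measure.pi fun _ : B' => η)) :
    ∃ W : Set (B → G), ∃ DG : Set (B' → G), ContinuousAt M U₀ ∧ IsOpen W ∧ U₀ ∈ W ∧ IsOpen DG ∧ M U₀ ∈ DG ∧
      ∀ r : (B → G) → ℝ, Measurable r → (∀ U, 0 ≤ r U) → (∀ U, (U ∈ W → Q U) → ContinuousAt r U) →
        (∃ C₀ : ℝ, ∀ U, r U ≤ C₀) → (∀ U, U ∉ W → r U = 0) →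
        ∃ I : (B' → G) → ℝ, ContinuousOn I DG ∧ (∀ V, 0 ≤ I V) ∧ ∀ S' : Set (B' → G), MeasurableSet S' → S' ⊆ DG →
          ((Measure.pi fun _ : B => μ).withDensity fun U => ENNReal.ofReal (r U)) (M ⁻¹' S') =
            ∫⁻ V in S', ENNReal.ofReal (I V) ∂(Measure.pi fun _ : B' => μ) := by
  haveI : T2Space G := h.isClosedEmbedding.isEmbedding.t2Space
  haveI := h.secondCountableTopology
  -- the radius: inside the chart radius and the non-degeneracy ball of `det jac`
  obtain ⟨s₀, hs₀, hpos⟩ := exists_ball_det_jac_pos hlie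
  set s : ℝ := min (chartRadius C) s₀ with hsdef
  have hs0 : 0 < s := lt_min chartRadius_pos hs₀
  have hs : s ≤ chartRadius C := min_le_left _ _
  have hjpos : ∀ x : C.lie, ‖x‖ < s → 0 < LinearMap.det (jac hlie x : C.lie →ₗ[ℝ] C.lie) :=
    fun x hx => hpos x (hx.trans_le (min_le_right _ _))
  -- the two sides' chart data
  obtain ⟨hΘXm, hΘXc, hΘXi, hΘXo, hJXm, hJXc, hJX0, hJXC, -, hcovX, -, -, -, hΘX0⟩ :=
    h.chartData_piExpChart_translate hlie η μ hs0 hs hjpos U₀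
  obtain ⟨hΘYm, -, hΘYi, hΘYo, hJYm, hJYc, hJY0, -, hJYpos, hcovY, hΛYm, hΛYc, hΛΘY, hΘY0⟩ :=
    h.chartData_piExpChart_translate hlie η μ hs0 hs hjpos (M U₀)
  -- the inner source ball: inside `B(0, s/2)` and the chart-readability region
  have hDGo : IsOpen ((fun (A : B' → C.lie) (b' : B') => h.expChart (A b') * M U₀ b') '' Metric.ball 0 s) :=
    hΘYo _ Subset.rfl Metric.isOpen_ball
  have hN : (fun A : B → C.lie => M (fun b => h.expChart (A b) * U₀ b)) ⁻¹'
      ((fun (A : B' → C.lie) (b' : B') => h.expChart (A b') * M U₀ b') '' Metric.ball 0 s) ∈ 𝓝 (0 : B → C.lie) := by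
    have h1 : ContinuousAt M ((fun (A : B → C.lie) (b : B) => h.expChart (A b) * U₀ b) 0) := by
      show ContinuousAt M (fun b => h.expChart ((0 : B → C.lie) b) * U₀ b)
      rw [hΘX0]
      exact hMc
    have hc : ContinuousAt (fun A : B → C.lie => M (fun b => h.expChart (A b) * U₀ b)) 0 :=
      h1.comp (hΘXc.continuousAt (Metric.isOpen_ball.mem_nhds (Metric.mem_ball_self hs0)))
    refine hc.preimage_mem_nhds (hDGo.mem_nhds ?_)
    show M (fun b => h.expChart ((0 : B → C.lie) b) * U₀ b) ∈ _
    rw [hΘX0]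
    exact ⟨0, Metric.mem_ball_self hs0, hΘY0⟩
  obtain ⟨t₁, ht₁, ht₁N⟩ := Metric.mem_nhds_iff.1 hN
  set t : ℝ := min (s / 2) t₁ with htdef
  have ht0 : 0 < t := lt_min (half_pos hs0) ht₁
  have hts : t < s := (min_le_left _ _).trans_lt (half_lt_self hs0)
  have hT₀T : closure (Metric.ball (0 : B → C.lie) t) ⊆ Metric.ball 0 s :=
    Metric.closure_ball_subset_closedBall.trans (Metric.closedBall_subset_ball hts)
  have hread : ∀ A ∈ Metric.ball (0 : B → C.lie) t,
      M ((fun (A : B → C.lie) (b : B) => h.expChart (A b) * U₀ b) A) ∈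
        (fun (A : B' → C.lie) (b' : B') => h.expChart (A b') * M U₀ b') '' Metric.ball 0 s :=
    fun A hA => ht₁N (Metric.ball_subset_ball (min_le_right _ _) hA)
  -- the flat face in the shape of the abstract lemma
  obtain ⟨O, D, hO, h0O, hD, h0D, hH⟩ := hflat
  have hbase : (fun b' => h.logChart (M ((fun (A : B → C.lie) (b : B) => h.expChart (A b) * U₀ b) 0) b' *
      (M U₀ b')⁻¹)) ∈ D := by
    have h1 : M ((fun (A : B → C.lie) (b : B) => h.expChart (A b) * U₀ b) 0) = M U₀ := by
      rw [show ((fun (A : B → C.lie) (b : B) => h.expChart (A b) * U₀ b) 0) = U₀ from hΘX0]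
    rw [h1]
    have h2 : (fun b' => h.logChart (M U₀ b' * (M U₀ b')⁻¹)) = 0 := by
      funext b'
      simp [h.logChart_one]
    rw [h2]
    exact h0D
  -- the abstract chart transport
  exact Literature.MeasureTheory.Integral.PushforwardDensityChartTransport.localFace_of_chartRead
    (Measure.pi fun _ : B => η) (Measure.pi fun _ : B' => η) (Measure.pi fun _ : B => μ) (Measure.pi fun _ : B' => μ)
    hΘXm Metric.isOpen_ball Metric.isOpen_ball hT₀T hΘXc hΘXi hΘXo hJXm hJXc hJX0 hJXC hcovX
    hΘYm Metric.isOpen_ball hΘYi hΘYo hΛYm hΛYc hΛΘY hJYm hJYc hJY0 hJYpos hcovY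
    hMm (Metric.mem_ball_self ht0) hΘX0 hMc hread Q ⟨O, D, hO, h0O, hD, hbase, hH⟩

/-! ## §5 Flat local faces at every point of a closed set ⇒ ONE continuous push-forward density on `G^{B'}` -/

include hlie in
/-- ★★★ **FROM FLAT LOCAL FACES TO A CONTINUOUS PUSH-FORWARD DENSITY ON THE WHOLE OF `G^{B'}`** (the local route, assembled at
the group).  `M : (B → G) → (B' → G)` measurable; `K` a closed set of configurations; at every `U₀ ∈ K`, `M` is continuous and the
chart-read map `A ↦ (b' ↦ Λ(M(Θ^B(A)·U₀) b' · (M U₀ b')⁻¹))` carries at `0` the FLAT local face w.r.t. `⊗_B η`, `⊗_{B'} η` (engine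
form, exemption `Q(Θ^B(A)·U₀)`).  THEN every measurable bounded `r ≥ 0` vanishing off `K` and continuous at each `U ∈ K` with `Q U`
has a push-forward density `g ≥ 0` under `M`, CONTINUOUS ON ALL OF `G^{B'}`, w.r.t. the product Haar measures:
`(r·⊗μ)(M⁻¹S) = ∫⁻_S g d(⊗μ)` for every measurable `S`, and the (0.13)-shaped test identity `∫ r·(f∘M) d(⊗μ) = ∫ g·f d(⊗μ)` for
every measurable real `f`.  (§4 at each `U₀ ∈ K` + `PushforwardDensityGluing.exists_continuous_density_of_locally'` on the compact
source `B → G` + `…integral_mul_comp_eq_integral_mul_of_forall_preimage`.)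
[cite: Helgason2000, Ch. I §1 Thm. 1.14 (13) p. 96] [cite: Balaban1985UV3, (18) p. 260] [cite: Balaban1987RG1, (0.13) p.254 (bookkeeping)] -/
theorem exists_continuous_density_pi_haar_of_flatLocalFaces [μ.IsMulRightInvariant] {B' : Type*} [Fintype B']
    {M : (B → G) → (B' → G)} (hMm : Measurable M) (Q : (B → G) → Prop) {K : Set (B → G)} (hK : IsClosed K)
    (hface : ∀ U₀ ∈ K, ContinuousAt M U₀ ∧
      ∃ O : Set (B → C.lie), ∃ D : Set (B' → C.lie), IsOpen O ∧ (0 : B → C.lie) ∈ O ∧ IsOpen D ∧ (0 : B' → C.lie) ∈ D ∧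
      ∀ r : (B → C.lie) → ℝ, Measurable r → (∀ A, 0 ≤ r A) →
        (∀ A ∈ O, Q (fun b => h.expChart (A b) * U₀ b) → ContinuousAt r A) →
        (∃ C₀ : ℝ, ∀ A, r A ≤ C₀) → (∀ A, A ∉ O → r A = 0) →
        ∃ I : (B' → C.lie) → ℝ, ContinuousOn I D ∧ (∀ w, 0 ≤ I w) ∧ ∀ A' : Set (B' → C.lie), MeasurableSet A' → A' ⊆ D →
          ((Measure.pi fun _ : B => η).withDensity fun A => ENNReal.ofReal (r A))
              ((fun (A : B → C.lie) (b' : B') =>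
                  h.logChart (M (fun b => h.expChart (A b) * U₀ b) b' * (M U₀ b')⁻¹)) ⁻¹' A') =
            ∫⁻ w in A', ENNReal.ofReal (I w) ∂(Measure.pi fun _ : B' => η))
    (r : (B → G) → ℝ) (hrm : Measurable r) (hr0 : ∀ U, 0 ≤ r U) (hrc : ∀ U ∈ K, Q U → ContinuousAt r U)
    (hrC : ∃ C₀ : ℝ, ∀ U, r U ≤ C₀) (hrK : ∀ U, U ∉ K → r U = 0) :
    ∃ g : (B' → G) → ℝ, Continuous g ∧ (∀ V, 0 ≤ g V) ∧
      (∀ S' : Set (B' → G), MeasurableSet S' →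
        ((Measure.pi fun _ : B => μ).withDensity fun U => ENNReal.ofReal (r U)) (M ⁻¹' S') =
          ∫⁻ V in S', ENNReal.ofReal (g V) ∂(Measure.pi fun _ : B' => μ)) ∧
      ∀ f : (B' → G) → ℝ, Measurable f →
        ∫ U, r U * f (M U) ∂(Measure.pi fun _ : B => μ) = ∫ V, g V * f V ∂(Measure.pi fun _ : B' => μ) := by
  haveI : T2Space G := h.isClosedEmbedding.isEmbedding.t2Space
  haveI := h.secondCountableTopology
  obtain ⟨g, hgc, hg0, hgA⟩ :=
    Literature.MeasureTheory.Integral.PushforwardDensityGluing.exists_continuous_density_of_locally'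
      (Measure.pi fun _ : B => μ) (Measure.pi fun _ : B' => μ) hMm Q hK.isCompact
      (fun U₀ hU₀ => h.localFace_pi_haar_of_chartRead hlie η μ hMm U₀ (hface U₀ hU₀).1 Q (hface U₀ hU₀).2)
      r hrm hr0 hrc hrC hrK
  exact ⟨g, hgc, hg0, hgA, fun f hf =>
    Literature.MeasureTheory.Integral.PushforwardDensityGluing.integral_mul_comp_eq_integral_mul_of_forall_preimage _ _ hMm
      hrm hr0 hgc.measurable hg0 hgA hf⟩

/-! ## §6 Bridge: the flat ENGINE-form face (conclusion shape of `SubmersionPushforward…`, `M a ∈ D` with `a = 0`) in the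
`hflat` shape of §4–§5 with the idle exemption `Q ≡ True` -/

omit [CompleteSpace 𝔸] [IsTopologicalGroup G] [CompactSpace G] [BorelSpace C.lie] [MeasurableSpace G] [BorelSpace G] [Fintype B]
  [FiniteDimensional ℝ C.lie] in
/-- **BRIDGE FROM THE ENGINE'S OUTPUT.**  The conclusion of `SubmersionPushforward.exists_continuousOn_density_map_of_submersion` for
the chart-read map `ψ = A ↦ (b' ↦ Λ(M(Θ^B(A)·U₀) b' · (M U₀ b')⁻¹))` at `a = 0` (as a producer states it: `ψ 0 ∈ D`, densities
`ContinuousOn` the window and bounded on it) IS the hypothesis `hflat` of `localFace_pi_haar_of_chartRead` ∕ the per-point clause of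
`exists_continuous_density_pi_haar_of_flatLocalFaces` with the idle exemption `Q ≡ True` (`ψ 0 = 0` since `Θ 0 = 1`, `Λ 1 = 0`).
[cite: Helgason2000, Ch. I §1 Thm. 1.14 (13) p. 96 (bookkeeping)] -/
theorem flatFace_chartRead_of_engineFace {B' : Type*} {Y' : Type*} [MeasurableSpace Y']
    (μE : Measure (B → C.lie)) (μY : Measure Y') {M : (B → G) → (B' → G)} (U₀ : B → G) {Λ' : (B' → G) → Y'} {D₀ : Y'}
    (hΛ' : Λ' (M U₀) = D₀) [TopologicalSpace Y']
    (hengine : ∃ O : Set (B → C.lie), IsOpen O ∧ (0 : B → C.lie) ∈ O ∧ ∃ D : Set Y', IsOpen D ∧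
      (fun A : B → C.lie => Λ' (M (fun b => h.expChart (A b) * U₀ b))) 0 ∈ D ∧
      ∀ r : (B → C.lie) → ℝ, Measurable r → (∀ A, 0 ≤ r A) → ContinuousOn r O → (∃ C₀ : ℝ, ∀ A ∈ O, r A ≤ C₀) →
        (∀ A, A ∉ O → r A = 0) →
        ∃ I : Y' → ℝ, ContinuousOn I D ∧ (∀ w, 0 ≤ I w) ∧ ∀ A' : Set Y', MeasurableSet A' → A' ⊆ D →
          (μE.withDensity fun A => ENNReal.ofReal (r A))
              ((fun A : B → C.lie => Λ' (M (fun b => h.expChart (A b) * U₀ b))) ⁻¹' A') =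
            ∫⁻ w in A', ENNReal.ofReal (I w) ∂μY) :
    ∃ O : Set (B → C.lie), ∃ D : Set Y', IsOpen O ∧ (0 : B → C.lie) ∈ O ∧ IsOpen D ∧ D₀ ∈ D ∧
      ∀ r : (B → C.lie) → ℝ, Measurable r → (∀ A, 0 ≤ r A) →
        (∀ A ∈ O, (fun _ : B → G => True) (fun b => h.expChart (A b) * U₀ b) → ContinuousAt r A) →
        (∃ C₀ : ℝ, ∀ A, r A ≤ C₀) → (∀ A, A ∉ O → r A = 0) →
        ∃ I : Y' → ℝ, ContinuousOn I D ∧ (∀ w, 0 ≤ I w) ∧ ∀ A' : Set Y', MeasurableSet A' → A' ⊆ D →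
          (μE.withDensity fun A => ENNReal.ofReal (r A))
              ((fun A : B → C.lie => Λ' (M (fun b => h.expChart (A b) * U₀ b))) ⁻¹' A') =
            ∫⁻ w in A', ENNReal.ofReal (I w) ∂μY := by
  obtain ⟨O, hO, h0O, D, hD, hψD, hH⟩ := hengine
  have hΘ0 : (fun b => h.expChart ((0 : B → C.lie) b) * U₀ b) = U₀ := by
    funext b
    simp [h.expChart_zero]
  have hD₀ : D₀ ∈ D := by
    have h1 : (fun A : B → C.lie => Λ' (M (fun b => h.expChart (A b) * U₀ b))) 0 = D₀ := by
      show Λ' (M (fun b => h.expChart ((0 : B → C.lie) b) * U₀ b)) = D₀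
      rw [hΘ0, hΛ']
    rw [← h1]
    exact hψD
  refine ⟨O, D, hO, h0O, hD, hD₀, fun r h1 h2 h3 h4 h5 => ?_⟩
  obtain ⟨C₀, hC₀⟩ := h4
  exact hH r h1 h2 (fun A hA => (h3 A hA trivial).continuousWithinAt) ⟨C₀, fun A _ => hC₀ A⟩ h5

omit [IsTopologicalGroup G] [CompactSpace G] [MeasurableSpace C.lie] [BorelSpace C.lie] [MeasurableSpace G] [BorelSpace G]
  [Fintype B] [FiniteDimensional ℝ C.lie] in
/-- The base-point identity used by the bridge at the product charts of §3–§5: `Λ^{B'}(M U₀ · (M U₀)⁻¹) = 0`.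
[cite: Helgason2000, Ch. I §1 Thm. 1.14 (13) p. 96 (bookkeeping)] -/
theorem piLogChart_translate_self {B' : Type*} {M : (B → G) → (B' → G)} (U₀ : B → G) :
    (fun b' => h.logChart (M U₀ b' * (M U₀ b')⁻¹)) = (0 : B' → C.lie) := by
  funext b'
  simp [h.logChart_one]

/-! ## §7 (v1.1, append-only) Bridge for the SHARP engines: the conclusion shape of `AnalyticSubmersion…_sharp` (or of any engine
whose densities are continuous only on a flat exemption set `Qflat`) in the `hflat` shape of §4–§5 with a configuration-space exemption
`Q` implied by `Qflat` -/

omit [CompleteSpace 𝔸] [IsTopologicalGroup G] [CompactSpace G] [BorelSpace C.lie] [MeasurableSpace G] [BorelSpace G] [Fintype B]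
  [FiniteDimensional ℝ C.lie] in
/-- **BRIDGE FROM A SHARP ENGINE'S OUTPUT.**  A flat local face of the chart-read map `ψ = A ↦ Λ'(M(Θ^B(A)·U₀))` at `a = 0` whose
densities are asked to be continuous only at the points of the window satisfying a FLAT exemption predicate `Qflat` (for
`AnalyticSubmersion.exists_continuousOn_density_map_of_analytic_submersion_sharp`: `Qflat A := g A ≠ 0` with the engine's threshold `g`; for
a finite family of thresholds: `Qflat A := ∀ i, g i A ≠ 0`), stated in the engine's own shape (`ψ 0 ∈ D`, densities bounded on the window),
IS the hypothesis `hflat` of `localFace_pi_haar_of_chartRead` ∕ the per-point clause of `exists_continuous_density_pi_haar_of_flatLocalFaces` for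
every configuration-space exemption `Q` with `Qflat A → Q(Θ^B(A)·U₀)` (at the record: `Qflat = Q ∘ (Θ^B(·)·U₀)` for the global threshold
predicate `Q U := «no (2.9) threshold is active at U»`).  §6 is the case `Qflat ≡ Q ≡ True`.
[cite: Helgason2000, Ch. I §1 Thm. 1.14 (13) p. 96 (bookkeeping)] -/
theorem flatFace_chartRead_of_sharpEngineFace {B' : Type*} {Y' : Type*} [MeasurableSpace Y']
    (μE : Measure (B → C.lie)) (μY : Measure Y') {M : (B → G) → (B' → G)} (U₀ : B → G) {Λ' : (B' → G) → Y'} {D₀ : Y'}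
    (hΛ' : Λ' (M U₀) = D₀) [TopologicalSpace Y'] (Q : (B → G) → Prop) (Qflat : (B → C.lie) → Prop)
    (hQ : ∀ A : B → C.lie, Qflat A → Q (fun b => h.expChart (A b) * U₀ b))
    (hengine : ∃ O : Set (B → C.lie), IsOpen O ∧ (0 : B → C.lie) ∈ O ∧ ∃ D : Set Y', IsOpen D ∧
      (fun A : B → C.lie => Λ' (M (fun b => h.expChart (A b) * U₀ b))) 0 ∈ D ∧
      ∀ r : (B → C.lie) → ℝ, Measurable r → (∀ A, 0 ≤ r A) → (∀ A ∈ O, Qflat A → ContinuousAt r A) →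
        (∃ C₀ : ℝ, ∀ A ∈ O, r A ≤ C₀) → (∀ A, A ∉ O → r A = 0) →
        ∃ I : Y' → ℝ, ContinuousOn I D ∧ (∀ w, 0 ≤ I w) ∧ ∀ A' : Set Y', MeasurableSet A' → A' ⊆ D →
          (μE.withDensity fun A => ENNReal.ofReal (r A))
              ((fun A : B → C.lie => Λ' (M (fun b => h.expChart (A b) * U₀ b))) ⁻¹' A') =
            ∫⁻ w in A', ENNReal.ofReal (I w) ∂μY) :
    ∃ O : Set (B → C.lie), ∃ D : Set Y', IsOpen O ∧ (0 : B → C.lie) ∈ O ∧ IsOpen D ∧ D₀ ∈ D ∧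
      ∀ r : (B → C.lie) → ℝ, Measurable r → (∀ A, 0 ≤ r A) →
        (∀ A ∈ O, Q (fun b => h.expChart (A b) * U₀ b) → ContinuousAt r A) →
        (∃ C₀ : ℝ, ∀ A, r A ≤ C₀) → (∀ A, A ∉ O → r A = 0) →
        ∃ I : Y' → ℝ, ContinuousOn I D ∧ (∀ w, 0 ≤ I w) ∧ ∀ A' : Set Y', MeasurableSet A' → A' ⊆ D →
          (μE.withDensity fun A => ENNReal.ofReal (r A))
              ((fun A : B → C.lie => Λ' (M (fun b => h.expChart (A b) * U₀ b))) ⁻¹' A') =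
            ∫⁻ w in A', ENNReal.ofReal (I w) ∂μY := by
  obtain ⟨O, hO, h0O, D, hD, hψD, hH⟩ := hengine
  have hΘ0 : (fun b => h.expChart ((0 : B → C.lie) b) * U₀ b) = U₀ := by
    funext b
    simp [h.expChart_zero]
  have hD₀ : D₀ ∈ D := by
    have h1 : (fun A : B → C.lie => Λ' (M (fun b => h.expChart (A b) * U₀ b))) 0 = D₀ := by
      show Λ' (M (fun b => h.expChart ((0 : B → C.lie) b) * U₀ b)) = D₀
      rw [hΘ0, hΛ']
    rw [← h1]
    exact hψD
  refine ⟨O, D, hO, h0O, hD, hD₀, fun r h1 h2 h3 h4 h5 => ?_⟩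
  obtain ⟨C₀, hC₀⟩ := h4
  exact hH r h1 h2 (fun A hA hQA => h3 A hA (hQ A hQA)) ⟨C₀, fun A _ => hC₀ A⟩ h5

/-! ## §8 (v1.1, append-only) The chain with SHARP-form flat faces: transport, gluing, and the two bookkeeping moves a producer
needs at a configuration where only SOME sharp thresholds are active (engine-form ⇒ sharp-form; window cut + exemption change) -/

include hlie in
/-- ★★★ **§4 WITH THE FLAT FACE IN SHARP FORM** (`PushforwardDensityChartTransport.localFace_of_chartRead'`): the flat face of the chart-read
map at `0` is asked only of densities continuous at EVERY point `A` with `A ∈ O → Q(Θ^B(A)·U₀)`; same conclusion as §4.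
[cite: Helgason2000, Ch. I §1 Thm. 1.14 (13) p. 96] [cite: Balaban1985UV3, (18) p. 260] -/
theorem localFace_pi_haar_of_chartRead' [μ.IsMulRightInvariant] {B' : Type*} [Fintype B']
    {M : (B → G) → (B' → G)} (hMm : Measurable M) (U₀ : B → G) (hMc : ContinuousAt M U₀) (Q : (B → G) → Prop)
    (hflat : ∃ O : Set (B → C.lie), ∃ D : Set (B' → C.lie), IsOpen O ∧ (0 : B → C.lie) ∈ O ∧ IsOpen D ∧
      (0 : B' → C.lie) ∈ D ∧
      ∀ r : (B → C.lie) → ℝ, Measurable r → (∀ A, 0 ≤ r A) →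
        (∀ A, (A ∈ O → Q (fun b => h.expChart (A b) * U₀ b)) → ContinuousAt r A) →
        (∃ C₀ : ℝ, ∀ A, r A ≤ C₀) → (∀ A, A ∉ O → r A = 0) →
        ∃ I : (B' → C.lie) → ℝ, ContinuousOn I D ∧ (∀ w, 0 ≤ I w) ∧ ∀ A' : Set (B' → C.lie), MeasurableSet A' → A' ⊆ D →
          ((Measure.pi fun _ : B => η).withDensity fun A => ENNReal.ofReal (r A))
              ((fun (A : B → C.lie) (b' : B') =>
                  h.logChart (M (fun b => h.expChart (A b) * U₀ b) b' * (M U₀ b')⁻¹)) ⁻¹' A') =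
            ∫⁻ w in A', ENNReal.ofReal (I w) ∂(Measure.pi fun _ : B' => η)) :
    ∃ W : Set (B → G), ∃ DG : Set (B' → G), ContinuousAt M U₀ ∧ IsOpen W ∧ U₀ ∈ W ∧ IsOpen DG ∧ M U₀ ∈ DG ∧
      ∀ r : (B → G) → ℝ, Measurable r → (∀ U, 0 ≤ r U) → (∀ U, (U ∈ W → Q U) → ContinuousAt r U) →
        (∃ C₀ : ℝ, ∀ U, r U ≤ C₀) → (∀ U, U ∉ W → r U = 0) →
        ∃ I : (B' → G) → ℝ, ContinuousOn I DG ∧ (∀ V, 0 ≤ I V) ∧ ∀ S' : Set (B' → G), MeasurableSet S' → S' ⊆ DG →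
          ((Measure.pi fun _ : B => μ).withDensity fun U => ENNReal.ofReal (r U)) (M ⁻¹' S') =
            ∫⁻ V in S', ENNReal.ofReal (I V) ∂(Measure.pi fun _ : B' => μ) := by
  haveI : T2Space G := h.isClosedEmbedding.isEmbedding.t2Space
  haveI := h.secondCountableTopology
  -- the radius: inside the chart radius and the non-degeneracy ball of `det jac`
  obtain ⟨s₀, hs₀, hpos⟩ := exists_ball_det_jac_pos hlie
  set s : ℝ := min (chartRadius C) s₀ with hsdef
  have hs0 : 0 < s := lt_min chartRadius_pos hs₀
  have hs : s ≤ chartRadius C := min_le_left _ _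
  have hjpos : ∀ x : C.lie, ‖x‖ < s → 0 < LinearMap.det (jac hlie x : C.lie →ₗ[ℝ] C.lie) :=
    fun x hx => hpos x (hx.trans_le (min_le_right _ _))
  -- the two sides' chart data
  obtain ⟨hΘXm, hΘXc, hΘXi, hΘXo, hJXm, hJXc, hJX0, hJXC, -, hcovX, -, -, -, hΘX0⟩ :=
    h.chartData_piExpChart_translate hlie η μ hs0 hs hjpos U₀
  obtain ⟨hΘYm, -, hΘYi, hΘYo, hJYm, hJYc, hJY0, -, hJYpos, hcovY, hΛYm, hΛYc, hΛΘY, hΘY0⟩ :=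
    h.chartData_piExpChart_translate hlie η μ hs0 hs hjpos (M U₀)
  -- the inner source ball: inside `B(0, s/2)` and the chart-readability region
  have hDGo : IsOpen ((fun (A : B' → C.lie) (b' : B') => h.expChart (A b') * M U₀ b') '' Metric.ball 0 s) :=
    hΘYo _ Subset.rfl Metric.isOpen_ball
  have hN : (fun A : B → C.lie => M (fun b => h.expChart (A b) * U₀ b)) ⁻¹'
      ((fun (A : B' → C.lie) (b' : B') => h.expChart (A b') * M U₀ b') '' Metric.ball 0 s) ∈ 𝓝 (0 : B → C.lie) := by
    have h1 : ContinuousAt M ((fun (A : B → C.lie) (b : B) => h.expChart (A b) * U₀ b) 0) := by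
      show ContinuousAt M (fun b => h.expChart ((0 : B → C.lie) b) * U₀ b)
      rw [hΘX0]
      exact hMc
    have hc : ContinuousAt (fun A : B → C.lie => M (fun b => h.expChart (A b) * U₀ b)) 0 :=
      h1.comp (hΘXc.continuousAt (Metric.isOpen_ball.mem_nhds (Metric.mem_ball_self hs0)))
    refine hc.preimage_mem_nhds (hDGo.mem_nhds ?_)
    show M (fun b => h.expChart ((0 : B → C.lie) b) * U₀ b) ∈ _
    rw [hΘX0]
    exact ⟨0, Metric.mem_ball_self hs0, hΘY0⟩
  obtain ⟨t₁, ht₁, ht₁N⟩ := Metric.mem_nhds_iff.1 hN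
  set t : ℝ := min (s / 2) t₁ with htdef
  have ht0 : 0 < t := lt_min (half_pos hs0) ht₁
  have hts : t < s := (min_le_left _ _).trans_lt (half_lt_self hs0)
  have hT₀T : closure (Metric.ball (0 : B → C.lie) t) ⊆ Metric.ball 0 s :=
    Metric.closure_ball_subset_closedBall.trans (Metric.closedBall_subset_ball hts)
  have hread : ∀ A ∈ Metric.ball (0 : B → C.lie) t,
      M ((fun (A : B → C.lie) (b : B) => h.expChart (A b) * U₀ b) A) ∈
        (fun (A : B' → C.lie) (b' : B') => h.expChart (A b') * M U₀ b') '' Metric.ball 0 s :=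
    fun A hA => ht₁N (Metric.ball_subset_ball (min_le_right _ _) hA)
  -- the flat face in the shape of the abstract lemma
  obtain ⟨O, D, hO, h0O, hD, h0D, hH⟩ := hflat
  have hbase : (fun b' => h.logChart (M ((fun (A : B → C.lie) (b : B) => h.expChart (A b) * U₀ b) 0) b' *
      (M U₀ b')⁻¹)) ∈ D := by
    have h1 : M ((fun (A : B → C.lie) (b : B) => h.expChart (A b) * U₀ b) 0) = M U₀ := by
      rw [show ((fun (A : B → C.lie) (b : B) => h.expChart (A b) * U₀ b) 0) = U₀ from hΘX0]
    rw [h1]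
    have h2 : (fun b' => h.logChart (M U₀ b' * (M U₀ b')⁻¹)) = 0 := by
      funext b'
      simp [h.logChart_one]
    rw [h2]
    exact h0D
  -- the abstract chart transport
  exact Literature.MeasureTheory.Integral.PushforwardDensityChartTransport.localFace_of_chartRead'
    (Measure.pi fun _ : B => η) (Measure.pi fun _ : B' => η) (Measure.pi fun _ : B => μ) (Measure.pi fun _ : B' => μ)
    hΘXm Metric.isOpen_ball Metric.isOpen_ball hT₀T hΘXc hΘXi hΘXo hJXm hJXc hJX0 hJXC hcovX
    hΘYm Metric.isOpen_ball hΘYi hΘYo hΛYm hΛYc hΛΘY hJYm hJYc hJY0 hJYpos hcovY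
    hMm (Metric.mem_ball_self ht0) hΘX0 hMc hread Q ⟨O, D, hO, h0O, hD, hbase, hH⟩


include hlie in
/-- ★★★ **§5 WITH SHARP-FORM FLAT FACES**: flat local faces in SHARP form at every point of a closed `K` ⇒ the continuous global push-forward
density and the (0.13) identity, exactly as `exists_continuous_density_pi_haar_of_flatLocalFaces`.
[cite: Helgason2000, Ch. I §1 Thm. 1.14 (13) p. 96] [cite: Balaban1985UV3, (18) p. 260] [cite: Balaban1987RG1, (0.13) p.254 (bookkeeping)] -/
theorem exists_continuous_density_pi_haar_of_flatLocalFaces' [μ.IsMulRightInvariant] {B' : Type*} [Fintype B']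
    {M : (B → G) → (B' → G)} (hMm : Measurable M) (Q : (B → G) → Prop) {K : Set (B → G)} (hK : IsClosed K)
    (hface : ∀ U₀ ∈ K, ContinuousAt M U₀ ∧
      ∃ O : Set (B → C.lie), ∃ D : Set (B' → C.lie), IsOpen O ∧ (0 : B → C.lie) ∈ O ∧ IsOpen D ∧ (0 : B' → C.lie) ∈ D ∧
      ∀ r : (B → C.lie) → ℝ, Measurable r → (∀ A, 0 ≤ r A) →
        (∀ A, (A ∈ O → Q (fun b => h.expChart (A b) * U₀ b)) → ContinuousAt r A) →
        (∃ C₀ : ℝ, ∀ A, r A ≤ C₀) → (∀ A, A ∉ O → r A = 0) →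
        ∃ I : (B' → C.lie) → ℝ, ContinuousOn I D ∧ (∀ w, 0 ≤ I w) ∧ ∀ A' : Set (B' → C.lie), MeasurableSet A' → A' ⊆ D →
          ((Measure.pi fun _ : B => η).withDensity fun A => ENNReal.ofReal (r A))
              ((fun (A : B → C.lie) (b' : B') =>
                  h.logChart (M (fun b => h.expChart (A b) * U₀ b) b' * (M U₀ b')⁻¹)) ⁻¹' A') =
            ∫⁻ w in A', ENNReal.ofReal (I w) ∂(Measure.pi fun _ : B' => η))
    (r : (B → G) → ℝ) (hrm : Measurable r) (hr0 : ∀ U, 0 ≤ r U) (hrc : ∀ U ∈ K, Q U → ContinuousAt r U)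
    (hrC : ∃ C₀ : ℝ, ∀ U, r U ≤ C₀) (hrK : ∀ U, U ∉ K → r U = 0) :
    ∃ g : (B' → G) → ℝ, Continuous g ∧ (∀ V, 0 ≤ g V) ∧
      (∀ S' : Set (B' → G), MeasurableSet S' →
        ((Measure.pi fun _ : B => μ).withDensity fun U => ENNReal.ofReal (r U)) (M ⁻¹' S') =
          ∫⁻ V in S', ENNReal.ofReal (g V) ∂(Measure.pi fun _ : B' => μ)) ∧
      ∀ f : (B' → G) → ℝ, Measurable f →
        ∫ U, r U * f (M U) ∂(Measure.pi fun _ : B => μ) = ∫ V, g V * f V ∂(Measure.pi fun _ : B' => μ) := by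
  haveI : T2Space G := h.isClosedEmbedding.isEmbedding.t2Space
  haveI := h.secondCountableTopology
  obtain ⟨g, hgc, hg0, hgA⟩ :=
    Literature.MeasureTheory.Integral.PushforwardDensityGluing.exists_continuous_density_of_locally'
      (Measure.pi fun _ : B => μ) (Measure.pi fun _ : B' => μ) hMm Q hK.isCompact
      (fun U₀ hU₀ => h.localFace_pi_haar_of_chartRead' hlie η μ hMm U₀ (hface U₀ hU₀).1 Q (hface U₀ hU₀).2)
      r hrm hr0 hrc hrC hrK
  exact ⟨g, hgc, hg0, hgA, fun f hf =>
    Literature.MeasureTheory.Integral.PushforwardDensityGluing.integral_mul_comp_eq_integral_mul_of_forall_preimage _ _ hMm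
      hrm hr0 hgc.measurable hg0 hgA hf⟩

omit [CompleteSpace 𝔸] [IsTopologicalGroup G] [CompactSpace G] [BorelSpace C.lie] [MeasurableSpace G] [BorelSpace G] [Fintype B]
  [FiniteDimensional ℝ C.lie] in
/-- **ENGINE-FORM ⇒ SHARP-FORM** (bookkeeping): a flat face asked of densities continuous at the `Qf`-points INSIDE the window yields the
sharp-form face asked only of densities continuous at every point off `O ∩ {¬Qf}` (fewer densities qualify).
[cite: Helgason2000, Ch. I §1 Thm. 1.14 (13) p. 96 (bookkeeping)] -/
theorem sharpFlatFace_of_flatFace {Y' : Type*} [MeasurableSpace Y'] [TopologicalSpace Y']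
    (μE : Measure (B → C.lie)) (μY : Measure Y') (ψ : (B → C.lie) → Y') (Qf : (B → C.lie) → Prop) {D₀ : Y'}
    (hface : ∃ O : Set (B → C.lie), ∃ D : Set Y', IsOpen O ∧ (0 : B → C.lie) ∈ O ∧ IsOpen D ∧ D₀ ∈ D ∧
      ∀ r : (B → C.lie) → ℝ, Measurable r → (∀ A, 0 ≤ r A) → (∀ A ∈ O, Qf A → ContinuousAt r A) →
        (∃ C₀ : ℝ, ∀ A, r A ≤ C₀) → (∀ A, A ∉ O → r A = 0) →
        ∃ I : Y' → ℝ, ContinuousOn I D ∧ (∀ w, 0 ≤ I w) ∧ ∀ A' : Set Y', MeasurableSet A' → A' ⊆ D →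
          (μE.withDensity fun A => ENNReal.ofReal (r A)) (ψ ⁻¹' A') = ∫⁻ w in A', ENNReal.ofReal (I w) ∂μY) :
    ∃ O : Set (B → C.lie), ∃ D : Set Y', IsOpen O ∧ (0 : B → C.lie) ∈ O ∧ IsOpen D ∧ D₀ ∈ D ∧
      ∀ r : (B → C.lie) → ℝ, Measurable r → (∀ A, 0 ≤ r A) → (∀ A, (A ∈ O → Qf A) → ContinuousAt r A) →
        (∃ C₀ : ℝ, ∀ A, r A ≤ C₀) → (∀ A, A ∉ O → r A = 0) →
        ∃ I : Y' → ℝ, ContinuousOn I D ∧ (∀ w, 0 ≤ I w) ∧ ∀ A' : Set Y', MeasurableSet A' → A' ⊆ D →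
          (μE.withDensity fun A => ENNReal.ofReal (r A)) (ψ ⁻¹' A') = ∫⁻ w in A', ENNReal.ofReal (I w) ∂μY := by
  obtain ⟨O, D, hO, h0O, hD, hD₀, hH⟩ := hface
  exact ⟨O, D, hO, h0O, hD, hD₀, fun r h1 h2 h3 h4 h5 => hH r h1 h2 (fun A hA hQ => h3 A fun _ => hQ) h4 h5⟩

omit [CompleteSpace 𝔸] [IsTopologicalGroup G] [CompactSpace G] [BorelSpace C.lie] [MeasurableSpace G] [BorelSpace G] [Fintype B]
  [FiniteDimensional ℝ C.lie] in
/-- **WINDOW CUT + EXEMPTION CHANGE for sharp-form flat faces** (bookkeeping): a sharp-form face with window `O` and exemption `Qf` yields,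
for every open `O' ∋ 0` inside `O` and every exemption `Qf'` implied by `Qf` ON `O'`, the sharp-form face with window `O'` and exemption `Qf'`.
USE: at a configuration `U₀` where the thresholds `i ∉ S` are INACTIVE (non-zero, hence non-zero on a neighbourhood `N`), the engine for the
active sub-family `S` gives `Qf A := ∀ i ∈ S, g_i A ≠ 0` on `O`; cut to `O' := O ∩ Λ-image of N` where `∀ i ∉ S, g_i ≠ 0`, and pass to the
global exemption `Qf' A := ∀ i, g_i A ≠ 0`. [cite: Helgason2000, Ch. I §1 Thm. 1.14 (13) p. 96 (bookkeeping)] -/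
theorem sharpFlatFace_cut {Y' : Type*} [MeasurableSpace Y'] [TopologicalSpace Y']
    (μE : Measure (B → C.lie)) (μY : Measure Y') (ψ : (B → C.lie) → Y') (Qf Qf' : (B → C.lie) → Prop) {D₀ : Y'}
    {O' : Set (B → C.lie)} (hO' : IsOpen O') (h0O' : (0 : B → C.lie) ∈ O')
    (hface : ∃ O : Set (B → C.lie), ∃ D : Set Y', IsOpen O ∧ (0 : B → C.lie) ∈ O ∧ IsOpen D ∧ D₀ ∈ D ∧ O' ⊆ O ∧
      (∀ A ∈ O', Qf A → Qf' A) ∧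
      ∀ r : (B → C.lie) → ℝ, Measurable r → (∀ A, 0 ≤ r A) → (∀ A, (A ∈ O → Qf A) → ContinuousAt r A) →
        (∃ C₀ : ℝ, ∀ A, r A ≤ C₀) → (∀ A, A ∉ O → r A = 0) →
        ∃ I : Y' → ℝ, ContinuousOn I D ∧ (∀ w, 0 ≤ I w) ∧ ∀ A' : Set Y', MeasurableSet A' → A' ⊆ D →
          (μE.withDensity fun A => ENNReal.ofReal (r A)) (ψ ⁻¹' A') = ∫⁻ w in A', ENNReal.ofReal (I w) ∂μY) :
    ∃ O : Set (B → C.lie), ∃ D : Set Y', IsOpen O ∧ (0 : B → C.lie) ∈ O ∧ IsOpen D ∧ D₀ ∈ D ∧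
      ∀ r : (B → C.lie) → ℝ, Measurable r → (∀ A, 0 ≤ r A) → (∀ A, (A ∈ O → Qf' A) → ContinuousAt r A) →
        (∃ C₀ : ℝ, ∀ A, r A ≤ C₀) → (∀ A, A ∉ O → r A = 0) →
        ∃ I : Y' → ℝ, ContinuousOn I D ∧ (∀ w, 0 ≤ I w) ∧ ∀ A' : Set Y', MeasurableSet A' → A' ⊆ D →
          (μE.withDensity fun A => ENNReal.ofReal (r A)) (ψ ⁻¹' A') = ∫⁻ w in A', ENNReal.ofReal (I w) ∂μY := by
  obtain ⟨O, D, hO, h0O, hD, hD₀, hO'O, hQQ, hH⟩ := hface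
  refine ⟨O', D, hO', h0O', hD, hD₀, fun r h1 h2 h3 h4 h5 => hH r h1 h2 (fun A hA => h3 A fun hA' => ?_) h4
    fun A hA => h5 A fun hA' => hA (hO'O hA')⟩
  exact hQQ A hA' (hA (hO'O hA'))

end IsChartRep

end Literature.MathematicalPhysics.QuantumFieldTheory.Balaban1983to89.HaarExponentialChart

end
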